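import Mathlib
import HarnessLib
import Summits.Langlands.Langlands.Theses.MaassFreeConverse

/-!
# Birth skeleton (BC3) for crux stmt-Langlands-13893
`Summit.Langlands.Langlands.Theses.MaassFreeConverse.CriticalValuesBettiRational` — line `birth`

Route `route-Langlands-MaassFreeConverse` (rev 6; `closes (hB : CriticalValuesBettiRational)
(hD : AlgebraicRelationsDecide) (hG : CriterionDescent) (hJ : RegularSectorJunction) : Langlands`; this crux is
`hB`, rank 2). THE CRUX: for `ρ : G_ℚ → GL_(m+1)(ℚ̄_ℓ)` irreducible, of admissible weight `wt`, Satake–Frobenius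
compatible a.e. over SOME number field `F` with a cuspidal cohomological `P` of weight `dual wt`, there are a
level `N ≥ 1`, a finite `S` and a card-`(m+1)` family `α` matching `ρ` off `S` such that for EVERY criterion datum
`(hc, s₀, D_even, D_odd, δ, R)` whose relation set `R` is killed by every GENUINE level-`N` weight-`wt` cusp form
(NECESSITY) the family `α` kills `R` too (KILL). By the refuters' certified analysis (item notes 2026-08-15:
TargetImpliesCrux.lean, Evidence.lean L1/L2) this is direction (B) in the regular sector "in value clothing":
true iff `ρ` is cuspidal automorphic over `ℚ` at some level `N` (mod bookkeeping), and no proof short of (B) in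
the sector is expected. The skeleton therefore does NOT pretend to cheapen the crux; it CUTS it along the
route header's two-layer plan (`CriticalValuesBettiRational ⇐ … → AlgebraicCoincidence`) into the two
bookkeeping lemmas that are provable now and ONE openly (B)-strength node stated in the finitary
"kill-basis" form in which the header's handle (coincidence with the level-`N` vectors) is a statement about
FINITELY MANY genuine forms and SINGLE relations:

* `stub_frobeniusSatakeFamily` (M, Galois bookkeeping, true) — a framed `ℓ`-adic `ρ` of `G_ℚ` whose restriction
  to SOME number field `F` is unramified a.e. has a finite `S` and a card-`n` family `α` with `ρ` unramified and
  `charpoly(Frob_v) = arithFrobPolyOfSatake ι q_v n (α v)` off `S` (inertia at places unramified in `F/ℚ` lies in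
  `Γ_F`; then `α :=` the landed `satakeFamilyOfFramedGaloisRep ι n ρ` of definition request D3,
  `Literature/NumberTheory/GaloisRepresentations/SatakeFamilyOfFramedGaloisRep`, does the rest:
  `card_satakeFamilyOfFramedGaloisRep`, `eventually_hasFrobCharpolyAt_satakeFamilyOfFramedGaloisRep`).
* `stub_killBasis_exists` (L, automorphic side, true) — at every `(m, N, wt, hc, s₀, D, δ)` with `m, N ≥ 1` a
  KILL-BASIS exists: finitely many genuine data `(π_i, απ_i)` that kill-dominate every genuine datum
  (`IsKillBasis`). Source of truth: Harish-Chandra finiteness of cusp forms of level `K(N)` and weight `wt`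
  (finitely many Satake families of genuine data; the tree's `AutomorphicRepData.hasSatakeParamAt_unique_holds`
  pins `απ` off `N`, and `IsValue` reads the family only at `v ∤ N`), so one representative per Satake family is
  a kill-basis with `γ' := γπ_(i₀)`; `k = 0` when no genuine datum exists.
* `stub_dominatedByKillBases` (XL, THE HEART — (B)-strength, said openly) — for `ρ` in the sector and ANY
  `(S, α)` matching `ρ` off `S` there is `N ≥ 1` such that `α` is kill-dominated by EVERY kill-basis at level `N`,
  for every datum. This is the header's AlgebraicCoincidence node in KILL-language ("the value vector of `ρ`
  behaves, relation by relation, like a vector in the span of the finitely many level-`N` vectors"): implied by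
  automorphy of `ρ` at level `N` (take `γ := γ'` of the domination clause for `(π₀, απ₀ = α off N)`; `N` absorbs
  `S` and the exceptional places), and with `AlgebraicRelationsDecide` + the other two stubs it gives the target
  back — exactly as the crux does. Why this cut and not the linear "span" form: KILL is NOT linear in the value
  vector (`E ≠ 0`, and `β` is free at `v ∈ S' ∩ supp N`), so span-membership does not imply the crux by logic,
  whereas kill-domination does; and forcing canonical bad factors (`γ := ∅`) on `α`'s side would make the node
  FALSE under (B) (the `v ∣ N` Euler factors of genuine values vary with `χ`). Handles (layer 2, informal in the
  header): Deligne/Raghuram algebraicity of the canonical values of `ρ ⊗ χ × τ` with Brauer-factorised periods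
  (PeriodFactorisation, along the support item SolubleJointPotentialAutomorphy) + Galois-equivariant coincidence
  of algebraic parts over the finite-dimensional `ℚ̄`-span of a kill-basis.
* `CriticalValuesBettiRational_of : stubs 1–3 → CriticalValuesBettiRational` — kernel-checked, no `sorry`:
  `(S, α)` from STUB 1 (fed the a.e.-unramifiedness of `ρ|_F` read off the sector's compatibility clause), `N`
  from STUB 3, then for a datum with NECESSITY: a kill-basis from STUB 2, NECESSITY at its finitely many members
  (finite choice of `γπ`), STUB 3 gives `γ`, and every `r ∈ R` is killed.

Shape (for `ledger skeleton check` / `#h21_check_skeleton`): stubs `theorem stub_<name> : <signature> := by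
sorry`; `_Goal.stub_<name> : Prop := type_of% @stub_<name>` names each statement; the composition takes
`(h₁ : _Goal.stub_frobeniusSatakeFamily) (h₂ : _Goal.stub_killBasis_exists) (h₃ : _Goal.stub_dominatedByKillBases)`
and concludes the route decl BY NAME; the final `example` feeds the three stubs to it. Sorries: exactly the three
stubs. Imports: exactly the route module (so that the verbatim sub-clauses elaborate to the route's terms).

Disproof used: none relevant — `ledger crux ls stmt-Langlands-13893` shows no workfiles (no `Disproof.lean`, no
`_false_without_` theorem, no Negative lemma) before this one. Refuter findings honoured instead (ATTACK.md ×2,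
Evidence.lean, TargetImpliesCrux.lean, Scratch.lean notes): the KILL clause is NECESSITY with `απ := α`
(the composition uses exactly that symmetry, through `KillsRel`); the vacuous-NECESSITY edge is real (a level
with no genuine forms admits the empty kill-basis, so STUB 3 forces genuine level-`N` forms to exist, as L2 says
the crux does); the free-`β` / free-`γ` slack is kept on both sides of every domination clause (never pinned).
-/

set_option linter.dupNamespace false

noncomputable section

namespace Summit.Langlands.Langlands.Cruxes.CriticalValuesBettiRational.Birth

open Summit.Langlands.Langlands.Theses.MaassFreeConverse
open scoped BigOperators Topology Classical NumberField
open Filter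
open Literature.NumberTheory.Automorphic Literature.NumberTheory.GaloisRepresentations
  Literature.NumberTheory.DiophantineGeometry Literature.Barriers.Langlands IsDedekindDomain NumberField

/-! ## 0. Named pieces of the crux (verbatim sub-clauses; `criticalValuesBettiRational_iff` is `Iff.rfl`) -/

/-- The admissibility clause of the sector: some pure weight `wt'` of `GL_m` leaves the three consecutive
critical shifts `j-1, j, j+1` interlacing with `wt` (verbatim from the crux). [folklore] -/
@[folklore] def Admissible (m : ℕ) (wt : Fin (m + 1) → ℤ) : Prop :=
  (∃ (wt' : Fin m → ℤ) (w' j : ℤ), (∀ i, wt' i + wt' (Fin.rev i) = w') ∧ (∀ i : Fin m, -(wt' i.rev + (j - 1)) ≤ wt i.castSucc ∧ wt i.succ ≤ -(wt' i.rev + (j - 1))) ∧ (∀ i : Fin m, -(wt' i.rev + j) ≤ wt i.castSucc ∧ wt i.succ ≤ -(wt' i.rev + j)) ∧ (∀ i : Fin m, -(wt' i.rev + (j + 1)) ≤ wt i.castSucc ∧ wt i.succ ≤ -(wt' i.rev + (j + 1))))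

/-- PROBE VALUE (verbatim value clause of the crux, for a general family `fam` in place of `α`/`απ`):
`z` is an admissible value of the probe `p = ((S', τ), q, χ)` for the card-`(m+1)` family `fam` with bad-factor
data `γ` at level `N`: there are Satake data `β` of `τ` off `S'`, the local multisets `L v` (`γ_v ⊗ β_v` at
`v ∣ N`, `fam_v ⊗ δ_v` at `v ∈ S'`, `v ∤ N`, `fam_v ⊗ β_v` elsewhere), the bound `‖y‖ < q_v^(Re s₀)`,
summability, the absolutely convergent `χ`-twisted Euler product tending to `E ≠ 0`, and
`z = D(τ, parity χ) · E`. [folklore] -/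
@[folklore] def IsValue (m N : ℕ) (hc : ∀ j : ℕ, isCompact_glFiniteIntegralLevel j ℚ) (s₀ : ℂ) (De Do : ((_ : Finset (HeightOneSpectrum (𝓞 ℚ))) × {τ : CuspidalAutomorphicRepData m ℚ (hc m) // τ.1.IsRegularAlgebraic}) → ℂ)
    (δ : ((_ : Finset (HeightOneSpectrum (𝓞 ℚ))) × {τ : CuspidalAutomorphicRepData m ℚ (hc m) // τ.1.IsRegularAlgebraic}) → HeightOneSpectrum (𝓞 ℚ) → Multiset ℂ) (γ fam : HeightOneSpectrum (𝓞 ℚ) → Multiset ℂ) (p : ((_ : ((_ : Finset (HeightOneSpectrum (𝓞 ℚ))) × {τ : CuspidalAutomorphicRepData m ℚ (hc m) // τ.1.IsRegularAlgebraic})) × (q : ℕ) × DirichletCharacter ℂ q)) (z : ℂ) : Prop :=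
  ∃ (β L : HeightOneSpectrum (𝓞 ℚ) → Multiset ℂ) (E : ℂ), (∀ v, v ∉ p.1.1 → p.1.2.1.1.HasSatakeParamAt v (β v)) ∧ (∀ v, L v = ((if v.asIdeal ∣ Ideal.span {(N : 𝓞 ℚ)} then γ v else fam v).bind fun a => (if ¬ v.asIdeal ∣ Ideal.span {(N : 𝓞 ℚ)} ∧ v ∈ p.1.1 then δ p.1 v else β v).map fun b => a * b)) ∧ (∀ v, ∀ y ∈ L v, ‖y‖ < (v.residueCard : ℝ) ^ s₀.re) ∧ (Summable fun v : HeightOneSpectrum (𝓞 ℚ) => ((L v).map fun y => ‖y‖ * (v.residueCard : ℝ) ^ (-s₀.re)).sum) ∧ Tendsto (fun X : ℕ => ∏ᶠ v ∈ {v : HeightOneSpectrum (𝓞 ℚ) | v.residueCard ≤ X}, ((L v).map fun y => (1 - y * p.2.2 (v.residueCard : ZMod p.2.1) * (v.residueCard : ℂ) ^ (-s₀))⁻¹).prod) atTop (𝓝 E) ∧ E ≠ 0 ∧ z = (if p.2.2.Even then De p.1 else Do p.1) * E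

/-- `fam` (with bad-factor data `γ`) KILLS the single relation `r`: some admissible value vector `z` on the
support of `r` has `∑_p r(p) z(p) = 0` (verbatim: the crux's `∃ z : _ → ℂ, (∀ p ∈ r.support, …) ∧ ∑ … = 0`). [folklore] -/
@[folklore] def KillsRel (m N : ℕ) (hc : ∀ j : ℕ, isCompact_glFiniteIntegralLevel j ℚ) (s₀ : ℂ) (De Do : ((_ : Finset (HeightOneSpectrum (𝓞 ℚ))) × {τ : CuspidalAutomorphicRepData m ℚ (hc m) // τ.1.IsRegularAlgebraic}) → ℂ)
    (δ : ((_ : Finset (HeightOneSpectrum (𝓞 ℚ))) × {τ : CuspidalAutomorphicRepData m ℚ (hc m) // τ.1.IsRegularAlgebraic}) → HeightOneSpectrum (𝓞 ℚ) → Multiset ℂ) (γ fam : HeightOneSpectrum (𝓞 ℚ) → Multiset ℂ) (r : ((_ : ((_ : Finset (HeightOneSpectrum (𝓞 ℚ))) × {τ : CuspidalAutomorphicRepData m ℚ (hc m) // τ.1.IsRegularAlgebraic})) × (q : ℕ) × DirichletCharacter ℂ q) →₀ ℂ) : Prop :=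
  ∃ z : ((_ : ((_ : Finset (HeightOneSpectrum (𝓞 ℚ))) × {τ : CuspidalAutomorphicRepData m ℚ (hc m) // τ.1.IsRegularAlgebraic})) × (q : ℕ) × DirichletCharacter ℂ q) → ℂ, (∀ p ∈ r.support, IsValue m N hc s₀ De Do δ γ fam p (z p)) ∧ ∑ p ∈ r.support, r p * z p = 0

/-- GENUINE level-`N` weight-`wt` datum (verbatim: the two hypotheses of the crux's NECESSITY clause): `π` is a
cuspidal automorphic representation of `GL_(m+1)(𝔸_ℚ)` of infinity type `cohomologicalInfinityType (dual wt)`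
with a `K(N)`-fixed form in `W ∖ W'`, and `απ` is a Satake family of `π` at every `v ∤ N`. [folklore] -/
@[folklore] def IsGenuine (m N : ℕ) (wt : Fin (m + 1) → ℤ) (hc : ∀ j : ℕ, isCompact_glFiniteIntegralLevel j ℚ)
    (π : CuspidalAutomorphicRepData (m + 1) ℚ (hc (m + 1))) (απ : HeightOneSpectrum (𝓞 ℚ) → Multiset ℂ) : Prop :=
  (π.1.HasInfinityType (cohomologicalInfinityType (m + 1) ℚ (Weight.dual wt)) ∧ ∃ φ ∈ π.1.W, φ ∉ π.1.W' ∧ ∀ u ∈ principalCongruenceLevel (m + 1) ℚ (Ideal.span {(N : 𝓞 ℚ)}), rightTranslation (AdelicGroupData.gl (m + 1) ℚ) u φ = φ) ∧ (∀ v, ¬ v.asIdeal ∣ Ideal.span {(N : 𝓞 ℚ)} → π.1.HasSatakeParamAt v (απ v))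

/-- KILL-BASIS (the line's one new object): finitely many genuine data `(π_i, απ_i)_(i<k)` such that every
genuine datum `(π', απ')` is KILL-DOMINATED by them — for every choice of bad-factor data `γπ_i` of the basis
there are bad-factor data `γ'` for `π'` with which `π'` kills every single relation the basis kills jointly.
(Automorphic side only; finiteness of level-`N` weight-`wt` cusp forms makes one exist, `stub_killBasis_exists`.) [folklore] -/
@[folklore] def IsKillBasis (m N : ℕ) (wt : Fin (m + 1) → ℤ) (hc : ∀ j : ℕ, isCompact_glFiniteIntegralLevel j ℚ) (s₀ : ℂ) (De Do : ((_ : Finset (HeightOneSpectrum (𝓞 ℚ))) × {τ : CuspidalAutomorphicRepData m ℚ (hc m) // τ.1.IsRegularAlgebraic}) → ℂ)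
    (δ : ((_ : Finset (HeightOneSpectrum (𝓞 ℚ))) × {τ : CuspidalAutomorphicRepData m ℚ (hc m) // τ.1.IsRegularAlgebraic}) → HeightOneSpectrum (𝓞 ℚ) → Multiset ℂ) (k : ℕ) (π : Fin k → CuspidalAutomorphicRepData (m + 1) ℚ (hc (m + 1)))
    (απ : Fin k → HeightOneSpectrum (𝓞 ℚ) → Multiset ℂ) : Prop :=
  (∀ i, IsGenuine m N wt hc (π i) (απ i)) ∧
    ∀ (π' : CuspidalAutomorphicRepData (m + 1) ℚ (hc (m + 1))) (απ' : HeightOneSpectrum (𝓞 ℚ) → Multiset ℂ),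
      IsGenuine m N wt hc π' απ' → ∀ γπ : Fin k → HeightOneSpectrum (𝓞 ℚ) → Multiset ℂ, ∃ γ' : HeightOneSpectrum (𝓞 ℚ) → Multiset ℂ,
        ∀ r : ((_ : ((_ : Finset (HeightOneSpectrum (𝓞 ℚ))) × {τ : CuspidalAutomorphicRepData m ℚ (hc m) // τ.1.IsRegularAlgebraic})) × (q : ℕ) × DirichletCharacter ℂ q) →₀ ℂ, (∀ i, KillsRel m N hc s₀ De Do δ (γπ i) (απ i) r) → KillsRel m N hc s₀ De Do δ γ' απ' r

/-- The crux read over `KillsRel` (definitional: NECESSITY and KILL are `∃ γ, ∀ r ∈ R, KillsRel … r`). [folklore] -/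
theorem criticalValuesBettiRational_iff : CriticalValuesBettiRational ↔
    ∀ (m : ℕ), 1 ≤ m → ∀ (ℓ : ℕ) [Fact ℓ.Prime] (ι : PadicAlgCl ℓ ≃+* ℂ) (ρ : FramedGaloisRep ℚ (PadicAlgCl ℓ) (m + 1)) (wt : Fin (m + 1) → ℤ) (F : Type) [Field F] [NumberField F] (hF : isCompact_glFiniteIntegralLevel (m + 1) F) (P : CuspidalAutomorphicRepData (m + 1) F hF), ρ.toGaloisRep.IsIrreducible → (∃ (wt' : Fin m → ℤ) (w' j : ℤ), (∀ i, wt' i + wt' (Fin.rev i) = w') ∧ (∀ i : Fin m, -(wt' i.rev + (j - 1)) ≤ wt i.castSucc ∧ wt i.succ ≤ -(wt' i.rev + (j - 1))) ∧ (∀ i : Fin m, -(wt' i.rev + j) ≤ wt i.castSucc ∧ wt i.succ ≤ -(wt' i.rev + j)) ∧ (∀ i : Fin m, -(wt' i.rev + (j + 1)) ≤ wt i.castSucc ∧ wt i.succ ≤ -(wt' i.rev + (j + 1)))) → P.1.HasInfinityType (cohomologicalInfinityType (m + 1) F (Weight.dual wt)) → (∀ᶠ w in cofinite, ∃ α, P.1.HasSatakeParamAt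 w α ∧ (ρ.restrictField F).IsUnramifiedAt w ∧ (ρ.restrictField F).HasFrobCharpolyAt w (arithFrobPolyOfSatake ι w.residueCard (m + 1) α)) → ∃ (N : ℕ) (S : Finset (HeightOneSpectrum (𝓞 ℚ))) (α : HeightOneSpectrum (𝓞 ℚ) → Multiset ℂ), 1 ≤ N ∧ (∀ v, Multiset.card (α v) = m + 1) ∧ (∀ v, v ∉ S → ρ.IsUnramifiedAt v ∧ ρ.HasFrobCharpolyAt v (arithFrobPolyOfSatake ι v.residueCard (m + 1) (α v))) ∧ ∀ (hc : ∀ j : ℕ, isCompact_glFiniteIntegralLevel j ℚ) (s₀ : ℂ) (De Do : ((_ : Finset (HeightOneSpectrum (𝓞 ℚ))) × {τ : CuspidalAutomorphicRepData m ℚ (hc m) // τ.1.IsRegularAlgebraic}) → ℂ) (δ : ((_ : Finset (HeightOneSpectrum (𝓞 ℚ))) × {τ : CuspidalAutomorphicRepData m ℚ (hc m) // τ.1.IsRegularAlgebraic}) → HeightOneSpectrum (𝓞 ℚ) → Multiset ℂ) (R : Set (((_ : ((_ : Finset (HeightOneSpectrum (𝓞 ℚ))) × {τ : CuspidalAutomorphicRepData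 m ℚ (hc m) // τ.1.IsRegularAlgebraic})) × (q : ℕ) × DirichletCharacter ℂ q) →₀ ℂ)), (∀ π : CuspidalAutomorphicRepData (m + 1) ℚ (hc (m + 1)), (π.1.HasInfinityType (cohomologicalInfinityType (m + 1) ℚ (Weight.dual wt)) ∧ ∃ φ ∈ π.1.W, φ ∉ π.1.W' ∧ ∀ u ∈ principalCongruenceLevel (m + 1) ℚ (Ideal.span {(N : 𝓞 ℚ)}), rightTranslation (AdelicGroupData.gl (m + 1) ℚ) u φ = φ) → ∀ απ : HeightOneSpectrum (𝓞 ℚ) → Multiset ℂ, (∀ v, ¬ v.asIdeal ∣ Ideal.span {(N : 𝓞 ℚ)} → π.1.HasSatakeParamAt v (απ v)) → ∃ γ : HeightOneSpectrum (𝓞 ℚ) → Multiset ℂ, ∀ r ∈ R, KillsRel m N hc s₀ De Do δ γ απ r) → ∃ γ : HeightOneSpectrum (𝓞 ℚ) → Multiset ℂ, ∀ r ∈ R, KillsRel m N hc s₀ De Do δ γ α r :=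
  Iff.rfl

/-! ## 1. The three stubs -/

/-- STUB 1 (M; Galois-side bookkeeping, true). A framed `ℓ`-adic representation `ρ` of `G_ℚ` whose
restriction to some number field `F` is unramified at all but finitely many places of `F` admits a finite set
`S` of rational places and a family `α` of card-`n` complex multisets such that off `S`, `ρ` is unramified and
every arithmetic Frobenius has characteristic polynomial `arithFrobPolyOfSatake ι q_v n (α v)` (HLTT shift
`e = n`). Proof route: for `v` unramified in `F/ℚ` and below no bad place, `I_𝔓(Γ_ℚ) ⊆ Γ_F` for `𝔓 ∣ v`, so
`ρ` is unramified at `v`; then `α := satakeFamilyOfFramedGaloisRep ι n ρ` (landed D3 file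
`GaloisRepresentations/SatakeFamilyOfFramedGaloisRep`: `card_…`, `eventually_hasFrobCharpolyAt_…`) and `S :=`
the finite exceptional set. -/
theorem stub_frobeniusSatakeFamily :
    ∀ (ℓ : ℕ) [Fact ℓ.Prime] (ι : PadicAlgCl ℓ ≃+* ℂ) (n : ℕ) (ρ : FramedGaloisRep ℚ (PadicAlgCl ℓ) n) (F : Type) [Field F] [NumberField F], (∀ᶠ w : HeightOneSpectrum (𝓞 F) in cofinite, (ρ.restrictField F).IsUnramifiedAt w) → ∃ (S : Finset (HeightOneSpectrum (𝓞 ℚ))) (α : HeightOneSpectrum (𝓞 ℚ) → Multiset ℂ), (∀ v, Multiset.card (α v) = n) ∧ ∀ v, v ∉ S → ρ.IsUnramifiedAt v ∧ ρ.HasFrobCharpolyAt v (arithFrobPolyOfSatake ι v.residueCard n (α v)) := by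
  sorry

/-- STUB 2 (L; automorphic side, true). KILL-BASES EXIST: for `m, N ≥ 1`, any weight, compactness facts and
datum `(s₀, D_even, D_odd, δ)` there are finitely many genuine level-`N` weight-`wt` data `(π_i, απ_i)_(i<k)`
kill-dominating every genuine datum (`IsKillBasis`). Proof route: genuine data have only FINITELY MANY Satake
families off `N` (Harish-Chandra finiteness of cusp forms of level `K(N)·K_∞` and the infinitesimal character of
`cohomologicalInfinityType (dual wt)`; `hasSatakeParamAt_unique_holds`); pick one genuine datum per family;
`IsValue`/`KillsRel` read the family only at `v ∤ N`, so a genuine `(π', απ')` with the family of `π_(i₀)` is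
dominated with `γ' := γπ i₀`; if no genuine datum exists, `k = 0`. -/
theorem stub_killBasis_exists :
    ∀ (m N : ℕ) (wt : Fin (m + 1) → ℤ) (hc : ∀ j : ℕ, isCompact_glFiniteIntegralLevel j ℚ) (s₀ : ℂ) (De Do : ((_ : Finset (HeightOneSpectrum (𝓞 ℚ))) × {τ : CuspidalAutomorphicRepData m ℚ (hc m) // τ.1.IsRegularAlgebraic}) → ℂ) (δ : ((_ : Finset (HeightOneSpectrum (𝓞 ℚ))) × {τ : CuspidalAutomorphicRepData m ℚ (hc m) // τ.1.IsRegularAlgebraic}) → HeightOneSpectrum (𝓞 ℚ) → Multiset ℂ), 1 ≤ m → 1 ≤ N → ∃ (k : ℕ) (π : Fin k → CuspidalAutomorphicRepData (m + 1) ℚ (hc (m + 1))) (απ : Fin k → HeightOneSpectrum (𝓞 ℚ) → Multiset ℂ), IsKillBasis m N wt hc s₀ De Do δ k π απ := by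
  sorry

/-- STUB 3 (XL; THE HEART, (B)-strength — the header's AlgebraicCoincidence node in KILL-language). For `ρ` in
the sector (irreducible, admissible `wt`, Satake–Frobenius compatible a.e. over some `F` with a cuspidal `P` of
infinity type `cohomologicalInfinityType (dual wt)`) and ANY `(S, α)` matching `ρ` off `S`, there is a level
`N ≥ 1` at which `α` is KILL-DOMINATED BY EVERY KILL-BASIS, for every datum: whatever bad-factor data the basis
members use, some bad-factor data `γ` let `α` kill every single relation the basis kills jointly. Implied by
cuspidal automorphy of `ρ` over `ℚ` in weight `wt` (level `N :=` level of `π₀` times the primes of `S` and of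
the exceptional set; `γ := γ'` from the basis' domination of `(π₀, α)`); conversely STUBS 1–3 give the crux and
hence, with AlgebraicRelationsDecide, the target (CriterionDescent) — no proof short of (B) in the sector is
claimed. Handles: PeriodFactorisation (Deligne–Raghuram algebraicity of the canonical `γ = ∅` values of
`ρ ⊗ χ × τ`, periods factorised along the Brauer sum of SolubleJointPotentialAutomorphy) and Galois-equivariant
coincidence of algebraic parts inside the finite-dimensional span of a kill-basis. -/
theorem stub_dominatedByKillBases :
    ∀ (m : ℕ), 1 ≤ m → ∀ (ℓ : ℕ) [Fact ℓ.Prime] (ι : PadicAlgCl ℓ ≃+* ℂ) (ρ : FramedGaloisRep ℚ (PadicAlgCl ℓ) (m + 1)) (wt : Fin (m + 1) → ℤ) (F : Type) [Field F] [NumberField F] (hF : isCompact_glFiniteIntegralLevel (m + 1) F) (P : CuspidalAutomorphicRepData (m + 1) F hF), ρ.toGaloisRep.IsIrreducible → (∃ (wt' : Fin m → ℤ) (w' j : ℤ), (∀ i, wt' i + wt' (Fin.rev i) = w') ∧ (∀ i : Fin m, -(wt' i.rev + (j - 1)) ≤ wt i.castSucc ∧ wt i.succ ≤ -(wt' i.rev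 + (j - 1))) ∧ (∀ i : Fin m, -(wt' i.rev + j) ≤ wt i.castSucc ∧ wt i.succ ≤ -(wt' i.rev + j)) ∧ (∀ i : Fin m, -(wt' i.rev + (j + 1)) ≤ wt i.castSucc ∧ wt i.succ ≤ -(wt' i.rev + (j + 1)))) → P.1.HasInfinityType (cohomologicalInfinityType (m + 1) F (Weight.dual wt)) → (∀ᶠ w in cofinite, ∃ α, P.1.HasSatakeParamAt w α ∧ (ρ.restrictField F).IsUnramifiedAt w ∧ (ρ.restrictField F).HasFrobCharpolyAt w (arithFrobPolyOfSatake ι w.residueCard (m + 1) α)) → ∀ (S : Finset (HeightOneSpectrum (𝓞 ℚ))) (α : HeightOneSpectrum (𝓞 ℚ) → Multiset ℂ), (∀ v, Multiset.card (α v) = m + 1) → (∀ v, v ∉ S → ρ.IsUnramifiedAt v ∧ ρ.HasFrobCharpolyAt v (arithFrobPolyOfSatake ι v.residueCard (m + 1) (α v))) → ∃ N : ℕ, 1 ≤ N ∧ ∀ (hc : ∀ j : ℕ, isCompact_glFiniteIntegralLevel j ℚ) (s₀ : ℂ) (De Do : ((_ : Finset (HeightOneSpectrum (𝓞 ℚ)))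 × {τ : CuspidalAutomorphicRepData m ℚ (hc m) // τ.1.IsRegularAlgebraic}) → ℂ) (δ : ((_ : Finset (HeightOneSpectrum (𝓞 ℚ))) × {τ : CuspidalAutomorphicRepData m ℚ (hc m) // τ.1.IsRegularAlgebraic}) → HeightOneSpectrum (𝓞 ℚ) → Multiset ℂ) (k : ℕ) (π : Fin k → CuspidalAutomorphicRepData (m + 1) ℚ (hc (m + 1))) (απ : Fin k → HeightOneSpectrum (𝓞 ℚ) → Multiset ℂ), IsKillBasis m N wt hc s₀ De Do δ k π απ → ∀ γπ : Fin k → HeightOneSpectrum (𝓞 ℚ) → Multiset ℂ, ∃ γ : HeightOneSpectrum (𝓞 ℚ) → Multiset ℂ, ∀ r : ((_ : ((_ : Finset (HeightOneSpectrum (𝓞 ℚ))) × {τ : CuspidalAutomorphicRepData m ℚ (hc m) // τ.1.IsRegularAlgebraic})) × (q : ℕ) × DirichletCharacter ℂ q) →₀ ℂ, (∀ i, KillsRel m N hc s₀ De Do δ (γπ i) (απ i) r) → KillsRel m N hc s₀ De Do δ γ α r := by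
  sorry

/-! ## 2. The stub statements by name (for the by-name hypotheses of the composition) -/

namespace _Goal

/-- The statement of `stub_frobeniusSatakeFamily` (literally its type). -/
@[folklore] def stub_frobeniusSatakeFamily : Prop :=
  type_of% @Summit.Langlands.Langlands.Cruxes.CriticalValuesBettiRational.Birth.stub_frobeniusSatakeFamily

/-- The statement of `stub_killBasis_exists` (literally its type). -/
@[folklore] def stub_killBasis_exists : Prop :=
  type_of% @Summit.Langlands.Langlands.Cruxes.CriticalValuesBettiRational.Birth.stub_killBasis_exists

/-- The statement of `stub_dominatedByKillBases` (literally its type). -/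
@[folklore] def stub_dominatedByKillBases : Prop :=
  type_of% @Summit.Langlands.Langlands.Cruxes.CriticalValuesBettiRational.Birth.stub_dominatedByKillBases

end _Goal

/-! ## 3. Composition (kernel-checked, no `sorry`): STUBS 1–3 ⟹ `CriticalValuesBettiRational` BY NAME -/

/-- **The line decides the crux.** `(S, α)` from STUB 1, `N` from STUB 3; for a datum whose `R` satisfies
NECESSITY: a kill-basis from STUB 2, NECESSITY at its members gives their bad-factor data (finite choice),
STUB 3 gives `γ`, and each `r ∈ R` is killed by `α`. -/
theorem CriticalValuesBettiRational_of (h₁ : _Goal.stub_frobeniusSatakeFamily)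
    (h₂ : _Goal.stub_killBasis_exists) (h₃ : _Goal.stub_dominatedByKillBases) :
    CriticalValuesBettiRational := by
  intro m hm ℓ hℓ ι ρ wt F hFf hFn hF P hirr hadm hinf hcompat
  obtain ⟨S, α, hcard, hmatch⟩ :=
    h₁ ℓ ι (m + 1) ρ F (hcompat.mono fun w hw => hw.elim fun _ h => h.2.1)
  obtain ⟨N, hN, hdom⟩ := h₃ m hm ℓ ι ρ wt F hF P hirr hadm hinf hcompat S α hcard hmatch
  refine ⟨N, S, α, hN, hcard, hmatch, ?_⟩
  intro hc s₀ De Do δ R hNEC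
  obtain ⟨k, π, απ, hbasis⟩ := h₂ m N wt hc s₀ De Do δ hm hN
  have hγ : ∀ i : Fin k, ∃ γi : HeightOneSpectrum (𝓞 ℚ) → Multiset ℂ, ∀ r ∈ R, KillsRel m N hc s₀ De Do δ γi (απ i) r :=
    fun i => hNEC (π i) (hbasis.1 i).1 (απ i) (hbasis.1 i).2
  choose γπ hγπ using hγ
  obtain ⟨γ, hγ⟩ := hdom hc s₀ De Do δ k π απ hbasis γπ
  exact ⟨γ, fun r hr => hγ r fun i => hγπ i r hr⟩

/-- By-name sanity check (an `example`, not a declaration): the three stubs feed the composition. -/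
example : CriticalValuesBettiRational :=
  CriticalValuesBettiRational_of stub_frobeniusSatakeFamily stub_killBasis_exists stub_dominatedByKillBases

end Summit.Langlands.Langlands.Cruxes.CriticalValuesBettiRational.Birth

end
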